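import Summits.QuantumFields.YangMills.Theorems.BalabanUVNodesN21ClosenessJunction
import Summits.QuantumFields.BalabanUV.T4Continuum.Spine.NE3.PairLandauB8
import Summits.QuantumFields.YangMills.Theorems.BalabanUVNodesSpineRates
import HarnessLib

/-!
# Route «BalabanUVNodes», cluster K4 «SpineRates» — node N16 = NE3: THE HÖLDER-EXPONENT WINDOW of the out-edge N16 → N19.
# The covariant root with its third conjunct (Lip₂′ᶜ) at `ξ^{2+β}` instead of `ξ^3` — the PRINTED range of the (1.36) Hölder member,
# «β ≦ β₀ < 1» — still feeds NE7's four closeness coordinates GEOMETRICALLY below the plaquette margin `ξ²`, for every `β ∈ (2∕3, 1]`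

Cell `pub-ymgap`, seat `pub-ymgap-dag-n16-c` (R134 fan-out seat, strategy s1; HUMAN RULING D-0062; chair R424 venue), generation 2, file 8 (kernel evidence for the
located item «the Hölder-exponent pin of N16's N05-socket», `HOME/pub-ymgap-dag-n16-c/LOCATED-N16-HOLDER-PIN.md`, pub-ymgap INBOX DAGN16C-G2-LOCATED-1).
`--supports stmt-QuantumFields-19908` (K3′ `SpineGivenEndpointR12`; helper).  `bears_on: R4∕N16 · out-edge N16 → N19 · GAPS caveat (c2)`.

WHY.  N16's statement of record `YMDAG.UVSplit.N16At c := NE3EnergyRateWCov 4 (sfClass …) … c.Λ₁ c.Λ₂' c.dom` carries, inside its `∃ (u, Z)`, the conjunct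
(Lip₂′ᶜ) «second transported covariant differences of `Z` ≤ `Λ₂′·ξ^3`», `ξ = (L⁻¹)^k` — the image at the pair of the (1.36) Hölder member of
[Balaban1985RegularSpaces] Theorem 2 AT EXPONENT `β = 1` (`ξ^{2+β}` at exponent `β`).  Print has «β ≦ β₀ < 1» (p. 82; p. 83 «such information is unavailable
for the second order derivatives»; [Balaban1985BackgroundPropagators] (3.43)–(3.45)), and everything of N16 below the root is already β-parametric in the tree
(`NE3.PairLandauB8.LandauRepB8.holder ≤ s₂·ξ^{(2:ℝ)+β}`, n16-a's `thm4OutputLandau138_of_thm4OutputPrint`, this seat's `thm4TorusAt_print_of_leaf`).  The ONLY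
consumer of (Lip₂′ᶜ) is NE7 route #1's one-dimensional interpolation `NE7EtaCovariantJunction.norm_covDiff_le_two_sqrt` inside
`NE7EtaRatesD4Cov.norm_covDiff_le_rate`.  THIS FILE re-runs that consumer step with the exponent a LETTER: with (Lip₂′ᶜ)_β the covariant-gradient, curl and
plaquette coordinates come at rate `(θ^k)^{10+3β}` (`θ⁶ = L⁻¹`; `β = 1` is the landed `θ^{13k}`), and `(θ^k)^{10+3β} = ξ²·(θ^{3β−2})^k` with `θ^{3β−2} < 1` exactly
when `β > 2∕3` — so a restatement of the root's third conjunct at a PRINTED exponent `β₀ ∈ (2∕3, 1)` costs NE7 nothing but the numerical rate, and is a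
WEAKENING of the present `N16At` (§4).  The restatement itself is planner business; nothing here edits a statement.

WHAT THIS FILE PROVES (kernel, theorems only, 0 `def`, 0 sorry):
§1 `norm_covDiff_le_rate_holder`, `norm_curl_le_rate_holder`, `norm_hol_sub_le_rate_holder` — (Gᶜ) `≤ 4l₁√(2γΛ₂′)·(θ^k)^{10+3β}`, (C) `≤ 8l₁√(2γΛ₂′)·(θ^k)^{10+3β}`,
   (Q) `≤ (8l₁√(2γΛ₂′) + 1536l₁⁴γ²e^{8l₁²γ})·(θ^k)^{10+3β}` (the last for `β ≤ 2`) from (E) + (Lip₁ᶜ) + (Lip₂′ᶜ)_β + FIT, one `N L^k`-periodic pair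
   `(W, Z)`, `W` unitary — `NE7EtaRatesD4Cov` ∕ `NE7EtaCurlFromCovGradient` with `3 ↦ 2 + β`.
§2 `rate_holder_eq_margin_mul` (`(θ^k)^{10+3β} = ((L⁻¹)^k)^2 · (θ^{3β−2})^k`), `rate_base_lt_one_of_window` (`2∕3 < β ⇒ θ^{3β−2} < 1`),
   `rate_holder_le_margin` (`2∕3 ≤ β ⇒ (θ^k)^{10+3β} ≤ ξ²`; `θ < 1` is n21-a's `N21ClosenessJunction.theta_lt_one`).
§3 `closeness_of_covRoot_holder` — NE7's consumer-side END (`NE7EtaCurlFromCovGradient.closeness_of_covRoot₂`) from the covariant root WITH (Lip₂′ᶜ)_β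
   (hypothesis inline, eight conjuncts), `0 ≤ β ≤ 1`: (P) `θ^{8k}`, (Gᶜ)∕(C)∕(Q) `(θ^k)^{10+3β}`.
§4 `lip_holder_of_pairLandauGaugeB8` — the NE3-side currencies at exponent `β` (`NE3.PairLandauB8.lip_of_pairLandauGaugeB8` without `β := 1`);
   `covRoot_holder_of_ne3EnergyRateWCov`, `covRoot_holder_of_n16At` — for `β ≤ 1` the root OF RECORD (resp. `N16At c`) IMPLIES the β-root: the restatement
   R-β is a weakening.
HONEST FRAMING: bookkeeping + one interpolation over landed modules; the β-root is a HYPOTHESIS (nobody's theorem); nothing of NE3 ∕ NE7 discharged;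
N16 ∕ NE3 NOT discharged; count-neutral; one finite four-torus at fixed ε — NOT ℝ⁴, NOT infinite volume, NOT OS, NOT a mass gap, NOT Clay.
-/

set_option autoImplicit false

open scoped BigOperators Matrix Matrix.Norms.L2Operator
open Finset

namespace Summit.QuantumFields.YangMills.BalabanUVNodes.N16HolderWindow

open Literature.MathematicalPhysics.QuantumFieldTheory.Balaban1983to89
open B7Prop1Explicit B7Prop2Explicit
open T4AveragingDeficitWall hiding Site Plane Plaq Bond
open T4AveragingDeficitWallBoundary (periodBox IsPeriodicCfg)
open Summit.QuantumFields.BalabanUV.T4Continuum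
open AveragingDeficitPeriodicCounting (IsPeriodicDir)
open AveragingDeficitDualResidual (dualC1 dualC2)
open AveragingDeficitDerivWallProof (wallConst)
open MinimalActionSandwich (IsMinimiser)
open MinimalActionRate (Regular sfClass)
open NE3EnergyShapes (residualScale IsUnitarySite IsPeriodicSite)
open NE3EnergyWeightedShapes (energyNormW)
open NE3EnergyWeightedCovShape (NE3EnergyRateWCov)
open NE3HessContinuity (bondL1At bondL1At_nonneg)
open NE3EnergySmallFieldCurl (norm_hol_vary_sub_hol_le_curl)
open NE7EtaRatesD4 (scale_eq scale_le_half energy_budget_of_residualScale)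
open NE7EtaRatesD4Cov (norm_dir_le_rate_cov)
open NE7EtaRatesD4CovReg (unitary_periodic_rescale_bavg_of_regular)
open NE7EtaCovariantJunction (norm_covDiff_le_two_sqrt)
open NE7EtaCurlFromCovGradient (norm_curl_le_two_mul_of_covDiff norm_curlAt_le_two_mul_of_covDiff)
open NE3.PairLandauB8 (LandauRepB8 PairLandauGaugeB8 IsLandauB8)
open YMDAG.UVSplit (NE3Carriers N16At)
open Summit.QuantumFields.YangMills.Theorems.N21ClosenessJunction (theta_lt_one)

noncomputable section

variable {n : Type*} [Fintype n] [DecidableEq n]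

/-! ## §0 Real-power bookkeeping for the rate `s^{10+3β}`, `s = θ^k` -/

/-- `(s⁶)^t = s^{6t}` for `s ≥ 0`. [folklore] -/
theorem rpow_pow_six {s : ℝ} (hs : 0 ≤ s) (t : ℝ) : (s ^ 6) ^ t = s ^ (6 * t) := by
  rw [← Real.rpow_natCast s 6, ← Real.rpow_mul hs]
  norm_num

/-- THE SQUARE ROOT OF THE INTERPOLATION PRODUCT: `√(8l₁²γ s⁸ · Λ₂′(s⁶)^{2+β}) = 2l₁·s^{10+3β}·√(2γΛ₂′)` (`s > 0`, `l₁ ≥ 0`; both sides square to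
`8l₁²γΛ₂′·s^{20+6β}`). [folklore] -/
theorem sqrt_interp_product {s l₁ γ Λ₂' β : ℝ} (hs : 0 < s) (hl₁ : 0 ≤ l₁) :
    Real.sqrt (8 * l₁ ^ 2 * γ * s ^ 8 * (Λ₂' * (s ^ 6) ^ ((2 : ℝ) + β)))
      = 2 * l₁ * s ^ ((10 : ℝ) + 3 * β) * Real.sqrt (2 * γ * Λ₂') := by
  have h8 : s ^ 8 * s ^ (6 * ((2 : ℝ) + β)) = s ^ ((20 : ℝ) + 6 * β) := by
    rw [← Real.rpow_natCast s 8, ← Real.rpow_add hs]; norm_num; ring_nf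
  have h2 : (s ^ ((10 : ℝ) + 3 * β)) ^ 2 = s ^ ((20 : ℝ) + 6 * β) := by
    rw [← Real.rpow_natCast (s ^ ((10 : ℝ) + 3 * β)) 2, ← Real.rpow_mul hs.le]; norm_num; ring_nf
  have e1 : 8 * l₁ ^ 2 * γ * s ^ 8 * (Λ₂' * (s ^ 6) ^ ((2 : ℝ) + β))
      = (2 * l₁ * s ^ ((10 : ℝ) + 3 * β)) ^ 2 * (2 * γ * Λ₂') := by
    rw [rpow_pow_six hs.le, mul_pow, h2, ← h8]; ring
  have ha : 0 ≤ 2 * l₁ * s ^ ((10 : ℝ) + 3 * β) := by positivity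
  rw [e1, Real.sqrt_mul (sq_nonneg _), Real.sqrt_sq ha]

/-! ## §1 The three coordinates from (E) + (Lip₁ᶜ) + (Lip₂′ᶜ)_β -/

/-- **THE COVARIANT GRADIENT COORDINATE AT HÖLDER EXPONENT `β`**: `d = 4`, `θ⁶ = L⁻¹`, one `N L^k`-periodic pair `(W, Z)`, `W` unitary; (E)
`L^k·energyNormW ≤ γ³`; (Lip₁ᶜ) `Λ₁ ≤ l₁³`; (Lip₂′ᶜ)_β «second transported covariant differences ≤ `Λ₂′·ξ^{2+β}`», `Λ₂′ > 0`; FIT `γ(θ^k)² ≤ l₁N`.  THEN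
`‖Ad (W (x + e κ) μ) (Z (x + e μ) κ) − Z x κ‖ ≤ 4l₁√(2γΛ₂′)·(θ^k)^{10+3β}` — `NE7EtaRatesD4Cov.norm_covDiff_le_rate` with `3 ↦ 2 + β` (its proof verbatim: the sup
bound (P) `8l₁²γθ^{8k}` of `norm_dir_le_rate_cov` and the interpolation `norm_covDiff_le_two_sqrt`). [folklore] -/
theorem norm_covDiff_le_rate_holder {L N k : ℕ} (hL : 2 ≤ L) (hN : 1 ≤ N) (hk : 1 ≤ k) {θ : ℝ} (hθ : 0 < θ)
    (hθ6 : θ ^ 6 = ((L : ℝ))⁻¹) {W : Site 4 → Fin 4 → (Matrix n n ℂ)ˣ} {Z : Site 4 → Fin 4 → Matrix n n ℂ}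
    (hWu : IsUnitaryCfg W) (hWP : IsPeriodicCfg W ((N * L ^ k : ℕ) : ℤ)) (hZP : IsPeriodicDir Z ((N * L ^ k : ℕ) : ℤ))
    {γ Λ₁ l₁ Λ₂' β : ℝ} (hγ : 0 < γ) (hl₁ : 0 < l₁) (hΛl : Λ₁ ≤ l₁ ^ 3) (hΛ₂' : 0 < Λ₂')
    (hE : (L : ℝ) ^ k * energyNormW L k W Z (periodBox (d := 4) (N * L ^ k)) ≤ γ ^ 3)
    (hlipc : ∀ (κ : Fin 4) (x : Site 4) (μ : Fin 4), ‖Ad (W (x + e κ) μ) (Z (x + e μ) κ) - Z x κ‖ ≤ Λ₁ * (((L : ℝ)⁻¹) ^ k) ^ 2)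
    (hlip2h : ∀ (κ μ : Fin 4) (y : Site 4),
      ‖Ad (W (y + e κ) μ) (Ad (W (y + e κ + e μ) μ) (Z (y + (2 : ℕ) • e μ) κ) - Z (y + e μ) κ)
        - (Ad (W (y + e κ) μ) (Z (y + e μ) κ) - Z y κ)‖ ≤ Λ₂' * (((L : ℝ)⁻¹) ^ k) ^ ((2 : ℝ) + β))
    (hfit : γ * (θ ^ k) ^ 2 ≤ l₁ * N) (x : Site 4) (μ κ : Fin 4) :
    ‖Ad (W (x + e κ) μ) (Z (x + e μ) κ) - Z x κ‖ ≤ 4 * l₁ * Real.sqrt (2 * γ * Λ₂') * (θ ^ k) ^ ((10 : ℝ) + 3 * β) := by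
  have hL1 : 1 ≤ L := by omega
  obtain ⟨hξ, -⟩ := scale_eq hL1 hθ6 k
  set s : ℝ := θ ^ k with hsdef
  have hs : 0 < s := pow_pos hθ k
  have hsup : ∀ y, ‖Z y κ‖ ≤ 8 * l₁ ^ 2 * γ * θ ^ (8 * k) := fun y =>
    norm_dir_le_rate_cov hL hN hk hθ hθ6 hWu hWP hZP hγ hl₁ hΛl hE hlipc hfit y κ
  have hM0 : 0 < 8 * l₁ ^ 2 * γ * θ ^ (8 * k) := by positivity
  have hl2 : 0 < Λ₂' * (((L : ℝ)⁻¹) ^ k) ^ ((2 : ℝ) + β) := by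
    rw [hξ]; exact mul_pos hΛ₂' (Real.rpow_pos_of_pos (pow_pos hs 6) _)
  have h := norm_covDiff_le_two_sqrt hWu κ μ hM0 hl2 hsup (hlip2h κ μ) x
  have e8 : θ ^ (8 * k) = s ^ 8 := by rw [hsdef, ← pow_mul, mul_comm k 8]
  have hsq : Real.sqrt (8 * l₁ ^ 2 * γ * θ ^ (8 * k) * (Λ₂' * (((L : ℝ)⁻¹) ^ k) ^ ((2 : ℝ) + β)))
      = 2 * l₁ * s ^ ((10 : ℝ) + 3 * β) * Real.sqrt (2 * γ * Λ₂') := by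
    rw [e8, hξ]; exact sqrt_interp_product hs hl₁.le
  calc ‖Ad (W (x + e κ) μ) (Z (x + e μ) κ) - Z x κ‖
      ≤ 2 * Real.sqrt (8 * l₁ ^ 2 * γ * θ ^ (8 * k) * (Λ₂' * (((L : ℝ)⁻¹) ^ k) ^ ((2 : ℝ) + β))) := h
    _ = 4 * l₁ * Real.sqrt (2 * γ * Λ₂') * s ^ ((10 : ℝ) + 3 * β) := by rw [hsq]; ring

/-- **THE CURL COORDINATE AT HÖLDER EXPONENT `β`** (same data): `‖d_W Z (x, π)‖ ≤ 8l₁√(2γΛ₂′)·(θ^k)^{10+3β}` — twice §1's gradient coordinate through the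
exact identity «dressed curl = difference of two transported covariant gradients» (`NE7EtaCurlFromCovGradient.norm_curl_le_two_mul_of_covDiff`). [folklore] -/
theorem norm_curl_le_rate_holder {L N k : ℕ} (hL : 2 ≤ L) (hN : 1 ≤ N) (hk : 1 ≤ k) {θ : ℝ} (hθ : 0 < θ)
    (hθ6 : θ ^ 6 = ((L : ℝ))⁻¹) {W : Site 4 → Fin 4 → (Matrix n n ℂ)ˣ} {Z : Site 4 → Fin 4 → Matrix n n ℂ}
    (hWu : IsUnitaryCfg W) (hWP : IsPeriodicCfg W ((N * L ^ k : ℕ) : ℤ)) (hZP : IsPeriodicDir Z ((N * L ^ k : ℕ) : ℤ))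
    {γ Λ₁ l₁ Λ₂' β : ℝ} (hγ : 0 < γ) (hl₁ : 0 < l₁) (hΛl : Λ₁ ≤ l₁ ^ 3) (hΛ₂' : 0 < Λ₂')
    (hE : (L : ℝ) ^ k * energyNormW L k W Z (periodBox (d := 4) (N * L ^ k)) ≤ γ ^ 3)
    (hlipc : ∀ (κ : Fin 4) (x : Site 4) (μ : Fin 4), ‖Ad (W (x + e κ) μ) (Z (x + e μ) κ) - Z x κ‖ ≤ Λ₁ * (((L : ℝ)⁻¹) ^ k) ^ 2)
    (hlip2h : ∀ (κ μ : Fin 4) (y : Site 4),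
      ‖Ad (W (y + e κ) μ) (Ad (W (y + e κ + e μ) μ) (Z (y + (2 : ℕ) • e μ) κ) - Z (y + e μ) κ)
        - (Ad (W (y + e κ) μ) (Z (y + e μ) κ) - Z y κ)‖ ≤ Λ₂' * (((L : ℝ)⁻¹) ^ k) ^ ((2 : ℝ) + β))
    (hfit : γ * (θ ^ k) ^ 2 ≤ l₁ * N) (π : T4AveragingDeficitWall.Plane 4) (x : Site 4) :
    ‖curl W Z (x, π)‖ ≤ 8 * l₁ * Real.sqrt (2 * γ * Λ₂') * (θ ^ k) ^ ((10 : ℝ) + 3 * β) := by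
  have hG : ∀ (κ : Fin 4) (x : Site 4) (μ : Fin 4),
      ‖Ad (W (x + e κ) μ) (Z (x + e μ) κ) - Z x κ‖ ≤ 4 * l₁ * Real.sqrt (2 * γ * Λ₂') * (θ ^ k) ^ ((10 : ℝ) + 3 * β) :=
    fun κ x μ => norm_covDiff_le_rate_holder hL hN hk hθ hθ6 hWu hWP hZP hγ hl₁ hΛl hΛ₂' hE hlipc hlip2h hfit x μ κ
  have h := norm_curl_le_two_mul_of_covDiff hWu hG π x
  linarith

/-- **THE PLAQUETTE COORDINATE AT HÖLDER EXPONENT `β`** (`W` unitary, `Z` skew, same data, `β ≤ 2`): for every plaquette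
`‖(W e^Z)(∂p) − W(∂p)‖ ≤ (8l₁√(2γΛ₂′) + 1536l₁⁴γ²e^{8l₁²γ})·(θ^k)^{10+3β}` — the NE3 crew's `norm_hol_vary_sub_hol_le_curl` with §1's curl bound and the sup bound
(P) in the exponential; the second-order term `∝ (θ^k)^{16}` is dominated by `(θ^k)^{10+3β}` because `10 + 3β ≤ 16` and `θ^k ≤ 1`
(`NE7EtaCurlFromCovGradient.norm_hol_sub_le_rate_of_covDiff` with `13 ↦ 10 + 3β`). [folklore] -/
theorem norm_hol_sub_le_rate_holder [Nonempty n] {L N k : ℕ} (hL : 2 ≤ L) (hN : 1 ≤ N) (hk : 1 ≤ k) {θ : ℝ} (hθ : 0 < θ)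
    (hθ6 : θ ^ 6 = ((L : ℝ))⁻¹) {W : Site 4 → Fin 4 → (Matrix n n ℂ)ˣ} {Z : Site 4 → Fin 4 → Matrix n n ℂ}
    (hWu : IsUnitaryCfg W) (hZs : IsSkewDir Z) (hWP : IsPeriodicCfg W ((N * L ^ k : ℕ) : ℤ))
    (hZP : IsPeriodicDir Z ((N * L ^ k : ℕ) : ℤ)) {γ Λ₁ l₁ Λ₂' β : ℝ} (hγ : 0 < γ) (hl₁ : 0 < l₁) (hΛl : Λ₁ ≤ l₁ ^ 3)
    (hΛ₂' : 0 < Λ₂') (hβ2 : β ≤ 2)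
    (hE : (L : ℝ) ^ k * energyNormW L k W Z (periodBox (d := 4) (N * L ^ k)) ≤ γ ^ 3)
    (hlipc : ∀ (κ : Fin 4) (x : Site 4) (μ : Fin 4), ‖Ad (W (x + e κ) μ) (Z (x + e μ) κ) - Z x κ‖ ≤ Λ₁ * (((L : ℝ)⁻¹) ^ k) ^ 2)
    (hlip2h : ∀ (κ μ : Fin 4) (y : Site 4),
      ‖Ad (W (y + e κ) μ) (Ad (W (y + e κ + e μ) μ) (Z (y + (2 : ℕ) • e μ) κ) - Z (y + e μ) κ)
        - (Ad (W (y + e κ) μ) (Z (y + e μ) κ) - Z y κ)‖ ≤ Λ₂' * (((L : ℝ)⁻¹) ^ k) ^ ((2 : ℝ) + β))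
    (hfit : γ * (θ ^ k) ^ 2 ≤ l₁ * N) (z : Site 4) (μ ν : Fin 4) :
    ‖((hol (vary W Z 1) z (plaqWord μ ν) : (Matrix n n ℂ)ˣ) : Matrix n n ℂ)
        - ((hol W z (plaqWord μ ν) : (Matrix n n ℂ)ˣ) : Matrix n n ℂ)‖
      ≤ (8 * l₁ * Real.sqrt (2 * γ * Λ₂') + 1536 * l₁ ^ 4 * γ ^ 2 * Real.exp (8 * l₁ ^ 2 * γ)) * (θ ^ k) ^ ((10 : ℝ) + 3 * β) := by
  obtain ⟨-, hs1⟩ := scale_le_half hL hθ hθ6 hk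
  set s : ℝ := θ ^ k with hsdef
  have hs : 0 < s := pow_pos hθ k
  set α : ℝ := 8 * l₁ ^ 2 * γ * θ ^ (8 * k) with hαdef
  have hsup : ∀ x κ, ‖Z x κ‖ ≤ α := fun x κ =>
    norm_dir_le_rate_cov hL hN hk hθ hθ6 hWu hWP hZP hγ hl₁ hΛl hE hlipc hfit x κ
  have hG : ∀ (κ : Fin 4) (x : Site 4) (μ : Fin 4),
      ‖Ad (W (x + e κ) μ) (Z (x + e μ) κ) - Z x κ‖ ≤ 4 * l₁ * Real.sqrt (2 * γ * Λ₂') * s ^ ((10 : ℝ) + 3 * β) :=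
    fun κ x μ => norm_covDiff_le_rate_holder hL hN hk hθ hθ6 hWu hWP hZP hγ hl₁ hΛl hΛ₂' hE hlipc hlip2h hfit x μ κ
  have hcurl : ‖curlAt W Z z μ ν‖ ≤ 8 * l₁ * Real.sqrt (2 * γ * Λ₂') * s ^ ((10 : ℝ) + 3 * β) := by
    have h := norm_curlAt_le_two_mul_of_covDiff hWu hG z μ ν
    linarith
  have h0 := norm_hol_vary_sub_hol_le_curl hWu hZs hsup (t := (1 : ℝ)) zero_le_one z μ ν
  rw [one_mul, one_mul] at h0
  have e8 : θ ^ (8 * k) = s ^ 8 := by rw [hsdef, ← pow_mul, mul_comm k 8]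
  have hα0 : 0 ≤ α := by positivity
  have hαs : α = 8 * l₁ ^ 2 * γ * s ^ 8 := by rw [hαdef, e8]
  have hs8 : s ^ 8 ≤ 1 := pow_le_one₀ hs.le hs1
  have hαle : α ≤ 8 * l₁ ^ 2 * γ := by
    rw [hαs]; nlinarith [mul_le_mul_of_nonneg_left hs8 (by positivity : (0 : ℝ) ≤ 8 * l₁ ^ 2 * γ)]
  have hexp1 : Real.exp α - 1 ≤ α * Real.exp α := by
    have h1 : Real.exp α * Real.exp (-α) = 1 := by rw [← Real.exp_add, add_neg_cancel, Real.exp_zero]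
    nlinarith [mul_le_mul_of_nonneg_left (Real.add_one_le_exp (-α)) (Real.exp_pos α).le, Real.exp_pos α]
  have hexp : Real.exp α - 1 ≤ α * Real.exp (8 * l₁ ^ 2 * γ) := hexp1.trans (mul_le_mul_of_nonneg_left (Real.exp_le_exp.mpr hαle) hα0)
  have hL1 : bondL1At Z z μ ν ≤ 4 * α := by
    unfold bondL1At; linarith [hsup z μ, hsup (z + e μ) ν, hsup (z + e ν) μ, hsup z ν]
  have h2 : 6 * (Real.exp α - 1) * bondL1At Z z μ ν ≤ 6 * (α * Real.exp (8 * l₁ ^ 2 * γ)) * (4 * α) :=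
    mul_le_mul (mul_le_mul_of_nonneg_left hexp (by norm_num)) hL1 (bondL1At_nonneg Z z μ ν) (by positivity)
  -- the second-order term `∝ s^{16}` is below the rate `s^{10+3β}` (`10 + 3β ≤ 16`, `s ≤ 1`)
  have hs16 : s ^ 16 ≤ s ^ ((10 : ℝ) + 3 * β) := by
    rw [← Real.rpow_natCast s 16]
    exact Real.rpow_le_rpow_of_exponent_ge hs hs1 (by push_cast; linarith)
  have h3 : 6 * (α * Real.exp (8 * l₁ ^ 2 * γ)) * (4 * α)
      ≤ 1536 * l₁ ^ 4 * γ ^ 2 * Real.exp (8 * l₁ ^ 2 * γ) * s ^ ((10 : ℝ) + 3 * β) := by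
    rw [hαs]
    have e1 : 6 * (8 * l₁ ^ 2 * γ * s ^ 8 * Real.exp (8 * l₁ ^ 2 * γ)) * (4 * (8 * l₁ ^ 2 * γ * s ^ 8))
        = 1536 * l₁ ^ 4 * γ ^ 2 * Real.exp (8 * l₁ ^ 2 * γ) * s ^ 16 := by ring
    rw [e1]
    exact mul_le_mul_of_nonneg_left hs16 (by positivity)
  calc ‖((hol (vary W Z 1) z (plaqWord μ ν) : (Matrix n n ℂ)ˣ) : Matrix n n ℂ)
          - ((hol W z (plaqWord μ ν) : (Matrix n n ℂ)ˣ) : Matrix n n ℂ)‖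
        ≤ ‖curlAt W Z z μ ν‖ + 6 * (Real.exp α - 1) * bondL1At Z z μ ν := h0
    _ ≤ 8 * l₁ * Real.sqrt (2 * γ * Λ₂') * s ^ ((10 : ℝ) + 3 * β)
          + 1536 * l₁ ^ 4 * γ ^ 2 * Real.exp (8 * l₁ ^ 2 * γ) * s ^ ((10 : ℝ) + 3 * β) :=
        add_le_add hcurl (h2.trans h3)
    _ = (8 * l₁ * Real.sqrt (2 * γ * Λ₂') + 1536 * l₁ ^ 4 * γ ^ 2 * Real.exp (8 * l₁ ^ 2 * γ)) * s ^ ((10 : ℝ) + 3 * β) := by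
        ring

/-! ## §2 The window: `(θ^k)^{10+3β} = ξ²·(θ^{3β−2})^k`, geometric below the margin exactly when `β > 2∕3` -/

/-- **THE SPLIT OF THE RATE AGAINST THE PLAQUETTE MARGIN**: `(θ^k)^{10+3β} = ((L⁻¹)^k)^2 · (θ^{3β−2})^k` (`θ⁶ = L⁻¹`, `θ > 0`, `L ≥ 1`) — the margin
`ξ² = θ^{12k}` times a per-level factor `θ^{3β−2}`. [folklore] -/
theorem rate_holder_eq_margin_mul {L : ℕ} (hL : 1 ≤ L) {θ : ℝ} (hθ : 0 < θ) (hθ6 : θ ^ 6 = ((L : ℝ))⁻¹) (β : ℝ) (k : ℕ) :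
    (θ ^ k) ^ ((10 : ℝ) + 3 * β) = (((L : ℝ)⁻¹) ^ k) ^ 2 * (θ ^ ((3 : ℝ) * β - 2)) ^ k := by
  obtain ⟨hξ, -⟩ := scale_eq hL hθ6 k
  have hs : 0 < θ ^ k := pow_pos hθ k
  rw [hξ]
  -- `(θ^k)^{10+3β} = (θ^k)^{12} · (θ^k)^{3β−2}` and `(θ^k)^{3β−2} = (θ^{3β−2})^k`
  have h12 : ((θ ^ k) ^ 6) ^ 2 = (θ ^ k) ^ (12 : ℝ) := by
    rw [← pow_mul, show (12 : ℝ) = ((12 : ℕ) : ℝ) by norm_num, Real.rpow_natCast]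
  have hsw : (θ ^ ((3 : ℝ) * β - 2)) ^ k = (θ ^ k) ^ ((3 : ℝ) * β - 2) := by
    rw [← Real.rpow_natCast (θ ^ ((3 : ℝ) * β - 2)) k, ← Real.rpow_mul hθ.le, mul_comm, Real.rpow_mul hθ.le, Real.rpow_natCast]
  rw [h12, hsw, ← Real.rpow_add hs]
  ring_nf

/-- **THE WINDOW**: for `2∕3 < β` the per-level factor is a genuine rate, `θ^{3β−2} < 1` (`0 < θ < 1`). [folklore] -/
theorem rate_base_lt_one_of_window {θ β : ℝ} (hθ : 0 < θ) (hθ1 : θ < 1) (hβ : 2 / 3 < β) : θ ^ ((3 : ℝ) * β - 2) < 1 :=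
  Real.rpow_lt_one hθ.le hθ1 (by linarith)

/-- … and it is at most `1` for `2∕3 ≤ β`, so the three coordinates of §1 are then AT OR BELOW the plaquette margin: `(θ^k)^{10+3β} ≤ ((L⁻¹)^k)^2`
(`θ⁶ = L⁻¹`, `L ≥ 2`). [folklore] -/
theorem rate_holder_le_margin {L : ℕ} (hL : 2 ≤ L) {θ : ℝ} (hθ : 0 < θ) (hθ6 : θ ^ 6 = ((L : ℝ))⁻¹) {β : ℝ} (hβ : 2 / 3 ≤ β) (k : ℕ) :
    (θ ^ k) ^ ((10 : ℝ) + 3 * β) ≤ (((L : ℝ)⁻¹) ^ k) ^ 2 := by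
  rw [rate_holder_eq_margin_mul (by omega) hθ hθ6 β k]
  have hθ1 : θ < 1 := theta_lt_one hL hθ6
  have hb1 : θ ^ ((3 : ℝ) * β - 2) ≤ 1 := Real.rpow_le_one hθ.le hθ1.le (by linarith)
  calc (((L : ℝ)⁻¹) ^ k) ^ 2 * (θ ^ ((3 : ℝ) * β - 2)) ^ k ≤ (((L : ℝ)⁻¹) ^ k) ^ 2 * 1 :=
        mul_le_mul_of_nonneg_left (pow_le_one₀ (Real.rpow_nonneg hθ.le _) hb1) (by positivity)
    _ = (((L : ℝ)⁻¹) ^ k) ^ 2 := mul_one _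

/-! ## §3 NE7's consumer-side END from the covariant root WITH (Lip₂′ᶜ) AT EXPONENT `β` -/

/-- **NE7's CONSUMER-SIDE END FROM THE β-ROOT** (`d = 4`, `L ≥ 2`, `N ≥ 1`, `θ⁶ = L⁻¹`, `0 ≤ b`, `512·5·8·L²·b ≤ 1`, `0 ≤ g`, `0 ≤ C`, `β ≤ 2`): `h` = the
covariant root `NE3EnergyRateWCov 4 𝒞 L N b g C Λ₁ Λ₂' dom` UNFOLDED with its third conjunct (Lip₂′ᶜ) RESTATED at exponent `β` (`≤ Λ₂′·ξ^{2+β}`; everything else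
token for token); budget `γ > 0` with `C·ρ₄ ≤ γ³`, cube root `l₁ > 0` with `Λ₁ ≤ l₁³`, `Λ₂′ > 0`.  THEN at every level `k ≥ 1` with the FIT `γ(θ^k)² ≤ l₁N`, for every
datum and minimiser pair: `∃ u Z` with the representation and (P) `θ^{8k}`, (Gᶜ)∕(C)∕(Q) at `(θ^k)^{10+3β}` — `NE7EtaCurlFromCovGradient.closeness_of_covRoot₂` with
`13 ↦ 10 + 3β`; by §2 the three rates sit GEOMETRICALLY below the plaquette margin `ξ²` iff `β > 2∕3`.  The β-root is a HYPOTHESIS — nobody's theorem. [folklore] -/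
theorem closeness_of_covRoot_holder [Nonempty n] {𝒞 : ℕ → Set (Site 4 → Fin 4 → (Matrix n n ℂ)ˣ)} {L N : ℕ} (hL : 2 ≤ L)
    (hN : 1 ≤ N) {θ : ℝ} (hθ : 0 < θ) (hθ6 : θ ^ 6 = ((L : ℝ))⁻¹) {b g C Λ₁ Λ₂' β : ℝ} (hb : 0 ≤ b)
    (hbs : 512 * (4 + 1) * (4 + 4) * (L : ℝ) ^ 2 * b ≤ 1) (hg : 0 ≤ g) (hC : 0 ≤ C) (hΛ₂' : 0 < Λ₂') (hβ2 : β ≤ 2)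
    {dom : Set (Site 4 → Fin 4 → (Matrix n n ℂ)ˣ)}
    (h : ∀ k : ℕ, 1 ≤ k → ∀ V ∈ dom, ∀ UA UB : Site 4 → Fin 4 → (Matrix n n ℂ)ˣ,
      IsMinimiser 4 𝒞 L N k V UA → IsMinimiser 4 𝒞 L N (k + 1) V UB → Regular 4 L N b g (k + 1) UB →
        ∃ (u : Site 4 → (Matrix n n ℂ)ˣ) (Z : Site 4 → Fin 4 → Matrix n n ℂ),
          IsUnitarySite u ∧ IsPeriodicSite u ((N * L ^ k : ℕ) : ℤ) ∧
          IsSkewDir Z ∧ IsPeriodicDir Z ((N * L ^ k : ℕ) : ℤ) ∧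
          gaugeAct u UA = vary (rescale L (bavg L UB)) Z 1 ∧
          energyNormW L k (rescale L (bavg L UB)) Z (periodBox (N * L ^ k)) ≤ C * residualScale 4 L N b g k ∧
          (∀ (κ : Fin 4) (x : Site 4) (μ : Fin 4),
            ‖Ad (rescale L (bavg L UB) (x + e κ) μ) (Z (x + e μ) κ) - Z x κ‖ ≤ Λ₁ * (((L : ℝ)⁻¹) ^ k) ^ 2) ∧
          (∀ (κ μ : Fin 4) (y : Site 4),
            ‖Ad (rescale L (bavg L UB) (y + e κ) μ)
                (Ad (rescale L (bavg L UB) (y + e κ + e μ) μ) (Z (y + (2 : ℕ) • e μ) κ) - Z (y + e μ) κ)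
              - (Ad (rescale L (bavg L UB) (y + e κ) μ) (Z (y + e μ) κ) - Z y κ)‖ ≤ Λ₂' * (((L : ℝ)⁻¹) ^ k) ^ ((2 : ℝ) + β)))
    {γ l₁ : ℝ} (hγ : 0 < γ)
    (hγ3 : C * (wallConst 4 L * (N : ℝ) ^ 2 * (Real.sqrt g * dualC2 4 L + 2 * b ^ 2 * dualC1 4 L)) ≤ γ ^ 3)
    (hl₁ : 0 < l₁) (hΛl₁ : Λ₁ ≤ l₁ ^ 3)
    {k : ℕ} (hk : 1 ≤ k) (hfit : γ * (θ ^ k) ^ 2 ≤ l₁ * N)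
    {V : Site 4 → Fin 4 → (Matrix n n ℂ)ˣ} (hV : V ∈ dom) {UA UB : Site 4 → Fin 4 → (Matrix n n ℂ)ˣ}
    (hA : IsMinimiser 4 𝒞 L N k V UA) (hB : IsMinimiser 4 𝒞 L N (k + 1) V UB) (hreg : Regular 4 L N b g (k + 1) UB) :
    ∃ (u : Site 4 → (Matrix n n ℂ)ˣ) (Z : Site 4 → Fin 4 → Matrix n n ℂ),
      IsUnitarySite u ∧ IsPeriodicSite u ((N * L ^ k : ℕ) : ℤ) ∧ IsSkewDir Z ∧ IsPeriodicDir Z ((N * L ^ k : ℕ) : ℤ) ∧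
      gaugeAct u UA = vary (rescale L (bavg L UB)) Z 1 ∧
      (∀ (x : Site 4) (κ : Fin 4), ‖Z x κ‖ ≤ 8 * l₁ ^ 2 * γ * θ ^ (8 * k)) ∧
      (∀ (x : Site 4) (μ κ : Fin 4),
        ‖Ad (rescale L (bavg L UB) (x + e κ) μ) (Z (x + e μ) κ) - Z x κ‖
          ≤ 4 * l₁ * Real.sqrt (2 * γ * Λ₂') * (θ ^ k) ^ ((10 : ℝ) + 3 * β)) ∧
      (∀ (π : T4AveragingDeficitWall.Plane 4) (x : Site 4),
        ‖curl (rescale L (bavg L UB)) Z (x, π)‖ ≤ 8 * l₁ * Real.sqrt (2 * γ * Λ₂') * (θ ^ k) ^ ((10 : ℝ) + 3 * β)) ∧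
      (∀ (z : Site 4) (μ ν : Fin 4),
        ‖((hol (gaugeAct u UA) z (plaqWord μ ν) : (Matrix n n ℂ)ˣ) : Matrix n n ℂ)
            - ((hol (rescale L (bavg L UB)) z (plaqWord μ ν) : (Matrix n n ℂ)ˣ) : Matrix n n ℂ)‖
          ≤ (8 * l₁ * Real.sqrt (2 * γ * Λ₂') + 1536 * l₁ ^ 4 * γ ^ 2 * Real.exp (8 * l₁ ^ 2 * γ))
              * (θ ^ k) ^ ((10 : ℝ) + 3 * β)) := by
  obtain ⟨u, Z, hu, huP, hZ, hZP, hrep, hE, h1, h2⟩ := h k hk V hV UA UB hA hB hreg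
  have hL1 : 1 ≤ L := by omega
  obtain ⟨hWu, hWP⟩ := unitary_periodic_rescale_bavg_of_regular hL1 hb hbs hreg
  have hEγ : (L : ℝ) ^ k * energyNormW L k (rescale L (bavg L UB)) Z (periodBox (d := 4) (N * L ^ k)) ≤ γ ^ 3 :=
    (energy_budget_of_residualScale hL1 N b hg hC k hE).trans hγ3
  refine ⟨u, Z, hu, huP, hZ, hZP, hrep, ?_, ?_, ?_, ?_⟩
  · exact fun x κ => norm_dir_le_rate_cov hL hN hk hθ hθ6 hWu hWP hZP hγ hl₁ hΛl₁ hEγ h1 hfit x κ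
  · exact fun x μ κ => norm_covDiff_le_rate_holder hL hN hk hθ hθ6 hWu hWP hZP hγ hl₁ hΛl₁ hΛ₂' hEγ h1 h2 hfit x μ κ
  · exact fun π x => norm_curl_le_rate_holder hL hN hk hθ hθ6 hWu hWP hZP hγ hl₁ hΛl₁ hΛ₂' hEγ h1 h2 hfit π x
  · intro z μ ν
    rw [hrep]
    exact norm_hol_sub_le_rate_holder hL hN hk hθ hθ6 hWu hZ hWP hZP hγ hl₁ hΛl₁ hΛ₂' hβ2 hEγ h1 h2 hfit z μ ν

/-! ## §4 The NE3 side: the printed-level currency at exponent `β`, and «root of record ⇒ β-root» (R-β is a weakening) -/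

section NE3Side

variable {d : ℕ}

/-- **THE CURRENCIES [B8] THEOREM 2 AT THE PAIR CARRIES, AT EXPONENT `β`** (any `d`; `NE3.PairLandauB8.lip_of_pairLandauGaugeB8` without `β := 1`): per pair,
the B8 representative `(u, Z)` of `PairLandauGaugeB8 d 𝒞 L N b g s₁ s₂ β dom` has the representation of the covariant root at `W = rescale L (bavg L U_B)`,
the (1.38) Landau gauge, the decaying sup bound `‖Z(b)‖ ≤ s₁·ξ`, (Lip₁ᶜ) with `Λ₁ = s₁`, and (Lip₂′ᶜ)_β with `Λ₂′ = s₂` at `ξ^{2+β}` — the field `holder`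
VERBATIM ([Balaban1985RegularSpaces] (1.36) third clause, «β ≦ β₀ < 1», reading (R-f) of `NE3.PairLandauB8`).  Everything of the β-root except the ENERGY
conjunct (NE3 proper). [folklore] -/
theorem lip_holder_of_pairLandauGaugeB8 {𝒞 : ℕ → Set (Site d → Fin d → (Matrix n n ℂ)ˣ)} {L N : ℕ} {b g s₁ s₂ β : ℝ}
    {dom : Set (Site d → Fin d → (Matrix n n ℂ)ˣ)} (h : PairLandauGaugeB8 d 𝒞 L N b g s₁ s₂ β dom)
    {k : ℕ} (hk : 1 ≤ k) {V : Site d → Fin d → (Matrix n n ℂ)ˣ} (hV : V ∈ dom) {UA UB : Site d → Fin d → (Matrix n n ℂ)ˣ}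
    (hA : IsMinimiser d 𝒞 L N k V UA) (hB : IsMinimiser d 𝒞 L N (k + 1) V UB) (hreg : Regular d L N b g (k + 1) UB) :
    ∃ (u : Site d → (Matrix n n ℂ)ˣ) (Z : Site d → Fin d → Matrix n n ℂ),
      IsUnitarySite u ∧ IsPeriodicSite u ((N * L ^ k : ℕ) : ℤ) ∧ IsSkewDir Z ∧ IsPeriodicDir Z ((N * L ^ k : ℕ) : ℤ) ∧
      gaugeAct u UA = vary (rescale L (bavg L UB)) Z 1 ∧
      IsLandauB8 L N k (rescale L (bavg L UB)) Z ∧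
      (∀ (x : Site d) (κ : Fin d), ‖Z x κ‖ ≤ s₁ * ((L : ℝ)⁻¹) ^ k) ∧
      (∀ (κ : Fin d) (x : Site d) (μ : Fin d),
        ‖Ad (rescale L (bavg L UB) (x + e κ) μ) (Z (x + e μ) κ) - Z x κ‖ ≤ s₁ * (((L : ℝ)⁻¹) ^ k) ^ 2) ∧
      (∀ (κ μ : Fin d) (y : Site d),
        ‖Ad (rescale L (bavg L UB) (y + e κ) μ)
            (Ad (rescale L (bavg L UB) (y + e κ + e μ) μ) (Z (y + (2 : ℕ) • e μ) κ) - Z (y + e μ) κ)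
          - (Ad (rescale L (bavg L UB) (y + e κ) μ) (Z (y + e μ) κ) - Z y κ)‖ ≤ s₂ * (((L : ℝ)⁻¹) ^ k) ^ ((2 : ℝ) + β)) := by
  obtain ⟨u, Z, hZ⟩ := h k hk V hV UA UB hA hB hreg
  exact ⟨u, Z, hZ.unitary, hZ.periodic, hZ.skew, hZ.per, hZ.rep, hZ.landau, hZ.sup, hZ.grad, hZ.holder⟩

/-- `ξ^3 ≤ ξ^{2+β}` for `ξ = (L⁻¹)^k`, `L ≥ 1`, `β ≤ 1` (`0 < ξ ≤ 1`). [folklore] -/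
theorem xi_cube_le_rpow {L : ℕ} (hL : 1 ≤ L) {β : ℝ} (hβ : β ≤ 1) (k : ℕ) :
    (((L : ℝ)⁻¹) ^ k) ^ 3 ≤ (((L : ℝ)⁻¹) ^ k) ^ ((2 : ℝ) + β) := by
  have hL1 : (1 : ℝ) ≤ (L : ℝ) := by exact_mod_cast hL
  have hξ0 : 0 < ((L : ℝ)⁻¹) ^ k := pow_pos (inv_pos.mpr (by linarith)) k
  have hξ1 : ((L : ℝ)⁻¹) ^ k ≤ 1 := pow_le_one₀ (inv_nonneg.mpr (by linarith)) (inv_le_one_of_one_le₀ hL1)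
  rw [← Real.rpow_natCast (((L : ℝ)⁻¹) ^ k) 3]
  exact Real.rpow_le_rpow_of_exponent_ge hξ0 hξ1 (by push_cast; linarith)

/-- **THE ROOT OF RECORD IMPLIES THE β-ROOT** (any `d`, `L ≥ 1`, `β ≤ 1`, `Λ₂′ ≥ 0`): `NE3EnergyRateWCov d 𝒞 L N b g C Λ₁ Λ₂' dom` (third conjunct at
`ξ^3`) gives the same eight-conjunct statement with (Lip₂′ᶜ) at `ξ^{2+β}` — because `ξ^3 ≤ ξ^{2+β}` on `ξ ∈ (0, 1]`.  So the restatement R-β of the located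
note (third conjunct at a printed exponent `β₀ < 1`) is a WEAKENING of the present root, and of `N16At`. [folklore] -/
theorem covRoot_holder_of_ne3EnergyRateWCov {𝒞 : ℕ → Set (Site d → Fin d → (Matrix n n ℂ)ˣ)} {L N : ℕ} (hL : 1 ≤ L) {b g C Λ₁ Λ₂' β : ℝ}
    (hβ : β ≤ 1) (hΛ₂' : 0 ≤ Λ₂') {dom : Set (Site d → Fin d → (Matrix n n ℂ)ˣ)} (h : NE3EnergyRateWCov d 𝒞 L N b g C Λ₁ Λ₂' dom) :
    ∀ k : ℕ, 1 ≤ k → ∀ V ∈ dom, ∀ UA UB : Site d → Fin d → (Matrix n n ℂ)ˣ,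
      IsMinimiser d 𝒞 L N k V UA → IsMinimiser d 𝒞 L N (k + 1) V UB → Regular d L N b g (k + 1) UB →
        ∃ (u : Site d → (Matrix n n ℂ)ˣ) (Z : Site d → Fin d → Matrix n n ℂ),
          IsUnitarySite u ∧ IsPeriodicSite u ((N * L ^ k : ℕ) : ℤ) ∧
          IsSkewDir Z ∧ IsPeriodicDir Z ((N * L ^ k : ℕ) : ℤ) ∧
          gaugeAct u UA = vary (rescale L (bavg L UB)) Z 1 ∧
          energyNormW L k (rescale L (bavg L UB)) Z (periodBox (N * L ^ k)) ≤ C * residualScale d L N b g k ∧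
          (∀ (κ : Fin d) (x : Site d) (μ : Fin d),
            ‖Ad (rescale L (bavg L UB) (x + e κ) μ) (Z (x + e μ) κ) - Z x κ‖ ≤ Λ₁ * (((L : ℝ)⁻¹) ^ k) ^ 2) ∧
          (∀ (κ μ : Fin d) (y : Site d),
            ‖Ad (rescale L (bavg L UB) (y + e κ) μ)
                (Ad (rescale L (bavg L UB) (y + e κ + e μ) μ) (Z (y + (2 : ℕ) • e μ) κ) - Z (y + e μ) κ)
              - (Ad (rescale L (bavg L UB) (y + e κ) μ) (Z (y + e μ) κ) - Z y κ)‖ ≤ Λ₂' * (((L : ℝ)⁻¹) ^ k) ^ ((2 : ℝ) + β)) := by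
  intro k hk V hV UA UB hA hB hreg
  obtain ⟨u, Z, hu, huP, hZ, hZP, hrep, hE, h1, h2⟩ := h k hk V hV UA UB hA hB hreg
  refine ⟨u, Z, hu, huP, hZ, hZP, hrep, hE, h1, fun κ μ y => (h2 κ μ y).trans ?_⟩
  exact mul_le_mul_of_nonneg_left (xi_cube_le_rpow hL hβ k) hΛ₂'

end NE3Side

/-- **N16's STATEMENT OF RECORD IMPLIES THE β-ROOT AT ITS BUNDLE** (`d = 4`, colour `Fin N`; `c.L ≥ 1`, `β ≤ 1`, `c.Λ₂' ≥ 0`): `N16At c` — i.e.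
`NE3EnergyRateWCov 4 (sfClass 4 c.L c.Nper c.ε) c.L c.Nper c.b c.g c.C c.Λ₁ c.Λ₂' c.dom` — gives the eight-conjunct root with (Lip₂′ᶜ) at `ξ^{2+β}`, the
hypothesis `h` of §3's `closeness_of_covRoot_holder` at `c`'s letters.  So re-wording `N16At`'s third conjunct at a printed exponent loses nothing the
N16 → N19 edge uses (§3) and asks less of node N05's socket (the located note's (F1)–(F4)). [folklore] -/
theorem covRoot_holder_of_n16At {N : ℕ} (c : NE3Carriers N) (h : N16At c) (hL : 1 ≤ c.L) {β : ℝ} (hβ : β ≤ 1) (hΛ : 0 ≤ c.Λ₂') :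
    ∀ k : ℕ, 1 ≤ k → ∀ V ∈ c.dom, ∀ UA UB : Site 4 → Fin 4 → (Matrix (Fin N) (Fin N) ℂ)ˣ,
      IsMinimiser 4 (sfClass 4 c.L c.Nper c.ε) c.L c.Nper k V UA → IsMinimiser 4 (sfClass 4 c.L c.Nper c.ε) c.L c.Nper (k + 1) V UB →
        Regular 4 c.L c.Nper c.b c.g (k + 1) UB →
        ∃ (u : Site 4 → (Matrix (Fin N) (Fin N) ℂ)ˣ) (Z : Site 4 → Fin 4 → Matrix (Fin N) (Fin N) ℂ),
          IsUnitarySite u ∧ IsPeriodicSite u ((c.Nper * c.L ^ k : ℕ) : ℤ) ∧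
          IsSkewDir Z ∧ IsPeriodicDir Z ((c.Nper * c.L ^ k : ℕ) : ℤ) ∧
          gaugeAct u UA = vary (rescale c.L (bavg c.L UB)) Z 1 ∧
          energyNormW c.L k (rescale c.L (bavg c.L UB)) Z (periodBox (c.Nper * c.L ^ k)) ≤ c.C * residualScale 4 c.L c.Nper c.b c.g k ∧
          (∀ (κ : Fin 4) (x : Site 4) (μ : Fin 4),
            ‖Ad (rescale c.L (bavg c.L UB) (x + e κ) μ) (Z (x + e μ) κ) - Z x κ‖ ≤ c.Λ₁ * (((c.L : ℝ)⁻¹) ^ k) ^ 2) ∧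
          (∀ (κ μ : Fin 4) (y : Site 4),
            ‖Ad (rescale c.L (bavg c.L UB) (y + e κ) μ)
                (Ad (rescale c.L (bavg c.L UB) (y + e κ + e μ) μ) (Z (y + (2 : ℕ) • e μ) κ) - Z (y + e μ) κ)
              - (Ad (rescale c.L (bavg c.L UB) (y + e κ) μ) (Z (y + e μ) κ) - Z y κ)‖ ≤ c.Λ₂' * (((c.L : ℝ)⁻¹) ^ k) ^ ((2 : ℝ) + β)) :=
  covRoot_holder_of_ne3EnergyRateWCov hL hβ hΛ h

end

end Summit.QuantumFields.YangMills.BalabanUVNodes.N16HolderWindow
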